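import Literature.AnabelianGeometry.SemiGraphs.TemperedLevelData
import Literature.AnabelianGeometry.SemiGraphs.TemperedCompactInVerticialFalseOfEscaping
import Literature.AnabelianGeometry.SemiGraphs.TemperedGroupsLimitFinite
import HarnessLib

/-!
# REFUTE-F1732, brick R6-limit: generic limit lemmas for an escaping compact subgroup

Mochizuki, *Semi-graphs of anabelioids*, Publ. RIMS **42** (2006), §3, Theorem 3.7 (iii), manuscript
pp. 40–41 [cite: MochizukiSemiAnbd2006, Thm 3.7(iii) pp.40-41].  The printed proof covers FINITE
underlying semi-graphs (kernel: `compactInVerticialAt_of_finiteGraph`); for the cell's ∀-countable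
typing `CompactInVerticial` a desk countermodel `𝒢_θ` (abc-iut-L3-d1 g3, memo
COUNTERMODEL-Thm37iii-infinite.md; four concurring readers; independent fifth derivation abc-iut-L3-t5 g4)
exhibits a compact `C ≅ ℤ_p` of `π₁^temp(𝒢_θ)` escaping along the ray.  Programme
SUBDAG-SemiAnbd-Thm37iii-REFUTE, brick **R6-limit** (abc-iut-L3-t5 g4): the GENERIC limit-side lemmas
the assembly (R7) needs, in binder form, proof-only, no definitions:

* over a `CountableDiscreteSystem` `S` (the currency of the canonical `π₁^temp = lim_n Gal(𝒢_{∞,n}/𝒢)`,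
  `TemperedPiSystem.lean`): a sequence whose coordinates are eventually constant defines a point of the
  limit (`mem_limit_of_eventually_eq`) and converges to it (`tendsto_of_eventually_eq`) — «`z_k → c`»
  as a `Tendsto` statement (the concrete completeness/compactness criteria «finite coordinates ⇒
  compact closure» are abc-iut-w4-d071's `TemperedPiCompactnessCriterion.lean`, consumed by name);
* over `D : VerticialLevelData 𝒢 c`: if for every base vertex `v` some level carries NO `C`-fixed tree
  vertex over `v` (the base images of the fixed loci have empty intersection — the «escape»), then `C`
  fixes no compatible vertex system, in the exact `hesc` shape of
  `VerticialLevelData.not_compactInVerticial_of_escaping` (p432161) (`escaping_of_forall_vertex`); the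
  height form along a ray (`escaping_of_height_unbounded`) is the seam with R6-level («the `c_j`-fixed
  vertices lie over positions `≥ m_j`, `m_j → ∞`»).

Nothing is constructed here; nothing bears on [IUTchIII] Cor. 3.12 (IUT uses finite dual graphs).
-/

namespace Literature.AnabelianGeometry.SemiGraphs

open Filter Topology

universe v u

/-! ### Limit-side lemmas over a `CountableDiscreteSystem` -/

namespace CountableDiscreteSystem

variable (S : CountableDiscreteSystem.{u})

/-- A family of coordinates that is, coordinatewise, the EVENTUAL value of a sequence of points of the
limit is itself a point of the limit («the eventual coordinates of `(z_k)` are compatible»).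
[cite: MochizukiSemiAnbd2006, Prop 3.6 p.38] -/
theorem mem_limit_of_eventually_eq (z : ℕ → S.limit) (w : ∀ i, S.obj i)
    (h : ∀ i, ∃ K, ∀ k, K ≤ k → S.proj i (z k) = w i) : w ∈ S.limit := by
  intro i j hij
  obtain ⟨K₁, hK₁⟩ := h i
  obtain ⟨K₂, hK₂⟩ := h j
  have h₁ := hK₁ (max K₁ K₂) (le_max_left _ _)
  have h₂ := hK₂ (max K₁ K₂) (le_max_right _ _)
  change (z (max K₁ K₂) : ∀ i, S.obj i) i = w i at h₁
  change (z (max K₁ K₂) : ∀ i, S.obj i) j = w j at h₂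
  rw [← h₁, ← h₂]
  exact (z (max K₁ K₂)).2 hij

/-- «`z_k → c`»: a sequence in the limit whose every coordinate eventually equals the corresponding
coordinate of `c` converges to `c` (product of discrete spaces). [cite: MochizukiSemiAnbd2006, Prop 3.6 p.38] -/
theorem tendsto_of_eventually_eq (z : ℕ → S.limit) (c : S.limit)
    (h : ∀ i, ∃ K, ∀ k, K ≤ k → S.proj i (z k) = S.proj i c) : Tendsto z atTop (𝓝 c) := by
  rw [Topology.IsEmbedding.subtypeVal.tendsto_nhds_iff, tendsto_pi_nhds]
  intro i
  obtain ⟨K, hK⟩ := h i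
  refine tendsto_const_nhds.congr' ?_
  rw [EventuallyEq, eventually_atTop]
  exact ⟨K, fun k hk => (hK k hk).symm⟩

end CountableDiscreteSystem

/-! ### Escape from level-wise emptiness of the fixed loci over each base vertex -/

namespace ProfiniteSemiGraph

namespace VerticialLevelData

open CategoryTheory

variable {𝒢 : ProfiniteSemiGraph.{u}} {c : TemperedPiChart 𝒢} (D : VerticialLevelData.{v} 𝒢 c)

/-- The base vertex of a compatible vertex system is the same at every level.
[cite: MochizukiSemiAnbd2006, Thm 3.7(iii) p.41] -/
theorem proj_vertexMap_eq_of_compatible (x : ∀ j, (D.tree j).Vertex)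
    (hx : ∀ ⦃i j : D.J⦄ (h : i ≤ j), (D.trans h).vertexMap (x j) = x i) (i j : D.J) :
    (D.proj i).vertexMap (x i) = (D.proj j).vertexMap (x j) := by
  -- compare both with a common upper bound
  have key : ∀ ⦃i k : D.J⦄ (h : i ≤ k), (D.proj i).vertexMap (x i) = (D.proj k).vertexMap (x k) := by
    intro i k h
    have := congrArg (fun f : D.tree k ⟶ 𝒢.graph => f.vertexMap (x k)) (D.trans_over h)
    simp only [SemiGraph.comp_vertexMap, Function.comp_apply] at this
    rw [hx h] at this
    exact this
  obtain ⟨k, hik, hjk⟩ := exists_ge_ge i j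
  rw [key hik, key hjk]

/-- **Escape ⇒ no compatible fixed system** (the `hesc` hypothesis of
`not_compactInVerticial_of_escaping`, p432161): if for every base vertex `v` there is a level at which
`C` fixes NO tree vertex over `v` — i.e. the base images of the `C`-fixed loci have empty intersection —
then every compatible vertex system is moved by some element of `C` at some level.
[cite: MochizukiSemiAnbd2006, Thm 3.7(iii) p.41] -/
theorem escaping_of_forall_vertex (C : Subgroup c.G)
    (h : ∀ v : 𝒢.graph.Vertex, ∃ j : D.J, ∀ y : (D.tree j).Vertex, (D.proj j).vertexMap y = v →
      ∃ g ∈ C, (D.act j g).hom.vertexMap y ≠ y) :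
    ∀ x : ∀ j, (D.tree j).Vertex, (∀ ⦃i j : D.J⦄ (h : i ≤ j), (D.trans h).vertexMap (x j) = x i) →
      ∃ g ∈ C, ∃ j, (D.act j g).hom.vertexMap (x j) ≠ x j := by
  intro x hx
  obtain ⟨j₀⟩ := D.nonempty
  obtain ⟨j, hj⟩ := h ((D.proj j₀).vertexMap (x j₀))
  obtain ⟨g, hg, hne⟩ := hj (x j) (D.proj_vertexMap_eq_of_compatible x hx j j₀)
  exact ⟨g, hg, j, hne⟩

/-- The same for a single element: if for every base vertex `v` some level carries no `g`-fixed tree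
vertex over `v`, then any subgroup containing `g` fixes no compatible vertex system.
[cite: MochizukiSemiAnbd2006, Thm 3.7(iii) p.41] -/
theorem escaping_of_mem_of_forall_vertex (C : Subgroup c.G) (g : c.G) (hg : g ∈ C)
    (h : ∀ v : 𝒢.graph.Vertex, ∃ j : D.J, ∀ y : (D.tree j).Vertex, (D.proj j).vertexMap y = v →
      (D.act j g).hom.vertexMap y ≠ y) :
    ∀ x : ∀ j, (D.tree j).Vertex, (∀ ⦃i j : D.J⦄ (h : i ≤ j), (D.trans h).vertexMap (x j) = x i) →
      ∃ g ∈ C, ∃ j, (D.act j g).hom.vertexMap (x j) ≠ x j :=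
  D.escaping_of_forall_vertex C fun v => by
    obtain ⟨j, hj⟩ := h v
    exact ⟨j, fun y hy => ⟨g, hg, hj y hy⟩⟩

/-- **Height form (the seam with R6-level)**: with a height function `ht` on the base vertices (the
position along the ray of `𝒢_θ`), if the heights of the base images of the `g`-fixed tree vertices are
unbounded from below along the levels («`c_j`-fixed vertices lie over positions `≥ m_j`, `m_j → ∞`»),
then any subgroup containing `g` fixes no compatible vertex system.
[cite: MochizukiSemiAnbd2006, Thm 3.7(iii) p.41] -/
theorem escaping_of_height_unbounded (C : Subgroup c.G) (g : c.G) (hg : g ∈ C)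
    (ht : 𝒢.graph.Vertex → ℕ)
    (h : ∀ N : ℕ, ∃ j : D.J, ∀ y : (D.tree j).Vertex, (D.act j g).hom.vertexMap y = y →
      N ≤ ht ((D.proj j).vertexMap y)) :
    ∀ x : ∀ j, (D.tree j).Vertex, (∀ ⦃i j : D.J⦄ (h : i ≤ j), (D.trans h).vertexMap (x j) = x i) →
      ∃ g ∈ C, ∃ j, (D.act j g).hom.vertexMap (x j) ≠ x j :=
  D.escaping_of_mem_of_forall_vertex C g hg fun v => by
    obtain ⟨j, hj⟩ := h (ht v + 1)
    refine ⟨j, fun y hy hfix => ?_⟩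
    have := hj y hfix
    rw [hy] at this
    omega

/-- **One-call form for the assembly (R7)**: a Thm-3.7 graph, a chart with level data, a compact
subgroup `C` containing an element `g` whose fixed tree vertices lie over base vertices of unbounded
height along the levels ⇒ `CompactInVerticialAt 𝒢` is false (composition of
`escaping_of_height_unbounded` with `not_compactInVerticialAt_of_escaping`, p432161). NEGATIVE-MODULO
form: nothing is constructed here. [cite: MochizukiSemiAnbd2006, Thm 3.7(iii) pp.40-41] -/
theorem not_compactInVerticialAt_of_height_unbounded (h37 : 𝒢.Thm37Hypotheses) (C : Subgroup c.G)
    (hC : IsCompact (C : Set c.G)) (g : c.G) (hg : g ∈ C) (ht : 𝒢.graph.Vertex → ℕ)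
    (h : ∀ N : ℕ, ∃ j : D.J, ∀ y : (D.tree j).Vertex, (D.act j g).hom.vertexMap y = y →
      N ≤ ht ((D.proj j).vertexMap y)) :
    ¬ CompactInVerticialAt 𝒢 :=
  D.not_compactInVerticialAt_of_escaping h37 C hC (D.escaping_of_height_unbounded C g hg ht h)

/-- … and `CompactInVerticial` (the ∀-countable named fact F-1732) is false. NEGATIVE-MODULO form.
[cite: MochizukiSemiAnbd2006, Thm 3.7(iii) pp.40-41] -/
theorem not_compactInVerticial_of_height_unbounded (h37 : 𝒢.Thm37Hypotheses) (C : Subgroup c.G)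
    (hC : IsCompact (C : Set c.G)) (g : c.G) (hg : g ∈ C) (ht : 𝒢.graph.Vertex → ℕ)
    (h : ∀ N : ℕ, ∃ j : D.J, ∀ y : (D.tree j).Vertex, (D.act j g).hom.vertexMap y = y →
      N ≤ ht ((D.proj j).vertexMap y)) :
    ¬ CompactInVerticial.{u} :=
  D.not_compactInVerticial_of_escaping h37 C hC (D.escaping_of_height_unbounded C g hg ht h)

/-- The «empty intersection of base images» form: if for every base vertex some level carries no
`g`-fixed tree vertex over it, then `CompactInVerticial` is false. NEGATIVE-MODULO form.
[cite: MochizukiSemiAnbd2006, Thm 3.7(iii) pp.40-41] -/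
theorem not_compactInVerticial_of_forall_vertex (h37 : 𝒢.Thm37Hypotheses) (C : Subgroup c.G)
    (hC : IsCompact (C : Set c.G)) (g : c.G) (hg : g ∈ C)
    (h : ∀ v : 𝒢.graph.Vertex, ∃ j : D.J, ∀ y : (D.tree j).Vertex, (D.proj j).vertexMap y = v →
      (D.act j g).hom.vertexMap y ≠ y) :
    ¬ CompactInVerticial.{u} :=
  D.not_compactInVerticial_of_escaping h37 C hC (D.escaping_of_mem_of_forall_vertex C g hg h)

end VerticialLevelData

end ProfiniteSemiGraph

end Literature.AnabelianGeometry.SemiGraphs
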